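import Summits.HodgeConjecture.HodgeConjecture.Cruxes.BlochSeedDiscOne.SeedChecker
import Summits.HodgeConjecture.HodgeConjecture.Theorems.WeilTypeLadderLocalAnchor
import HarnessLib

/-!
# Crux `BlochSeedDiscOne` — the R-B DOOR CHAIN, typed end-to-end (custody certificate of seat `hsemireg-sheaf8-1`)

HONEST FRAMING. This file is a CERTIFICATE OF WIRING, nothing else: it composes declarations that already exist in the tree
(`SeedChecker.lean` v3 §4–§6, `Summits/Ventures/HSemireg/SheafSeedOnAnchor.lean` §4,
`Theorems/WeilTypeLadderLocalAnchor.lean`) into single arrows, so that the bus sentence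

  «R-B object ⟶ `CleanAtSeed` C5–C8 packaging ⟶ `hasBFSheafSeedOn_of_cleanAtSeed` ⟶ `HasHyperbolicBFSheafSeedOn C 4 1 I`
   ⟶ `hasLocallyAlgebraicWeilAnchor_of_BFmodel_of_hyperbolicBFSheafSeedOn` (mod `BuchweitzFlenner2003_variationalHodge_ISemiregular_model`)
   ⟶ `HasLocallyAlgebraicWeilAnchor 4 1` = the `d = 1` slice of `splitEightfolds_of_reach_of_localAnchor`'s hypothesis»

(director-hodge R19.262 (1) ∕ (4), bc5-plan g12 (b)) is ONE kernel-checked implication per entrance, with every hypothesis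
in the binder list and nothing else. An «R-B object» here means: ON the anchor `pad4Anchor E₀ = (E₀ × E₀)⁴` (`E₀.dim = 1`,
`ψ₀ ≫ ψ₀ = -𝟙`), a FINITE LOCALLY FREE `𝒪`-module `𝓔` of ANY rank (8 in the R-B room), `I`-semiregular in a window
`4 ∈ I ⊆ {0,…,8}`, whose Chern character in the window is `ℚ[h] ⊕ ℚ·wOf μ` with `μ ≠ 0` — entered either directly
((A1@Z) = `CleanAtSeed`), or through the rank-`r` json checker `Design.SheafSeedCheckR`, or through a kernel ∕ cokernel ∕
monad PRESENTATION of a C0′ design (§6). The anchor data (`AnchorKit`: frame O-W, polarisation O-pol, hyperbolicity O-hyp;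
`WordKit`: a linked word frame O-WF) are design-independent typer obligations carried AS HYPOTHESES, exactly as in
`SeedChecker.lean`; the refereed input BF Thm. 5.1 is carried BY NAME (`BuchweitzFlenner2003_variationalHodge_ISemiregular_model`,
a `def : Prop`, displayed, not proved); Deligne's reach is carried BY NAME (`weilFamilyReach_hyperbolic`).

WHAT THE CHAIN DELIVERS AND WHAT IT DOES NOT (typed below, docstrings per arrow):
* delivers `HasLocallyAlgebraicWeilAnchor 4 1` (mod BF 5.1) and hence, with the reach, `Stubs.WeilAlgebraicSplitHyperplane 4 1`
  (every rational Weil class on every SPLIT `ℚ(i)`-Weil abelian eightfold algebraic) and `WeilAlgebraicAll n 1` for `2 ≤ n < 4`;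
* does NOT deliver `SplitEightfolds` (= `splitEightfolds_of_reach_of_localAnchor`'s conclusion), whose hypothesis is
  `∀ d, 0 < d → HasLocallyAlgebraicWeilAnchor 4 d` — the R-B room sits at `d = 1` only (`ψ₀² = -1` is hard-wired in
  `pad4Anchor`'s checks); the last theorem of this file records that the family over ALL `d` is what that rung consumes;
* does NOT touch crux item 18881 (`BlochSeedDiscOne` is the lci door with a rank-4 normal bundle; R-B ≠ 18881).

No `sorry`, no new definition, no instance, no notation, no named fact introduced here; axioms standard. Nothing in this
file says HC ∕ HC_CM ∕ HC_AV ∕ №4 ∕ 26512 ∕ 18881 ∕ H2 is proved: an address ≠ a design ≠ a display ≠ a sheaf ≠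
semiregular ≠ SEED, and no R-B object is constructed anywhere in the tree.

References: [BuchweitzFlenner2003] §5 Thm. 5.1; [Deligne1982HodgeCycles] proof of Thm. 4.8; [Markman2025SecantWeil] §1.2, §1.5.
-/

set_option linter.dupNamespace false

noncomputable section

open CategoryTheory AlgebraicGeometry
open Literature.AlgebraicGeometry Literature.AlgebraicGeometry.Motives Literature.AlgebraicGeometry.HodgeTheory
open Literature.AlgebraicTopology.SingularHomology

namespace Summit.HodgeConjecture.HodgeConjecture.Cruxes.BlochSeedDiscOne.RBDoorChain

open Summit.HodgeConjecture.HodgeConjecture.Cruxes.BlochSeedDiscOne.Anchor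
open Summit.HodgeConjecture.HodgeConjecture.Cruxes.BlochSeedDiscOne.SeedChecker
open Summit.Ventures.HSemireg Summit.Ventures.HSemireg.Pad4Tower
open Summit.HodgeConjecture.HodgeConjecture.WeilTypeLadder
open Summit.HodgeConjecture.HodgeConjecture.Cruxes.HodgeAbelianVarieties.EStepSecantInduction

variable {E₀ : AbelianVariety ℂ} {ψ₀ : E₀ ⟶ E₀} {C : ChernCharacterBetti}

/-! ## Entrance 1: (A1@Z) = `CleanAtSeed` directly (no design json; any rank) -/

/-- **R-B DOOR, `CleanAtSeed` entrance.** On the anchor `(E₀ × E₀)⁴` with an `AnchorKit K`, a finite locally free `𝓔`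
(any rank), `I`-semiregular with `4 ∈ I`, whose Chern character in the window `I` is `c_p·h_stdᵖ` (`p ≠ 4`) and
`q·h_std⁴ + wOf μ` with `μ ≠ 0`, gives — granting BF Thm. 5.1 (model rendering) — a locally algebraic hyperbolic
`ℚ(i)`-Weil anchor in dimension 8: `HasLocallyAlgebraicWeilAnchor 4 1`. Composition of
`cleanAtSeed_symH_of_hStd`, `hasBFSheafSeedOn_of_cleanAtSeed` (SeedChecker §4) and
`hasLocallyAlgebraicWeilAnchor_of_BFmodel_of_sheafSeedOn` (SheafSeedOnAnchor §3); the (4,1)-Weil data are the kit's.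
[cite: BuchweitzFlenner2003, §5 Thm. 5.1] [cite: Deligne1982HodgeCycles, proof of Thm. 4.8] -/
theorem hasLocallyAlgebraicWeilAnchor_four_one_of_cleanAtSeed (hE : E₀.dim = 1) (hψ : ψ₀ ≫ ψ₀ = -(1 • 𝟙 E₀))
    (hBF : BuchweitzFlenner2003_variationalHodge_ISemiregular_model) (K : AnchorKit E₀ ψ₀) {I : Finset ℕ}
    {𝓔 : (pad4Anchor E₀).X.left.Modules} {μ : GaussianInt} (hμ : μ ≠ 0) (h𝓔 : IsFiniteLocallyFree 𝓔) (h4 : 4 ∈ I)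
    (hsr : IsISemiregular h𝓔 {q' | q' + 1 ∈ I}) (hcl : CleanAtSeed C I K.F (hStd E₀ K.η) 𝓔 μ) :
    HasLocallyAlgebraicWeilAnchor 4 1 :=
  hasLocallyAlgebraicWeilAnchor_of_BFmodel_of_sheafSeedOn hBF (pad4Anchor E₀) (pad4Action E₀ ψ₀) K.pol.e K.pol.a
    (K.F.wOf μ) (pad4Anchor_dim hE) (pad4Action_comp_self hψ) K.pol.a_rational K.pol.a_ne_zero
    (K.hyperbolic_symH hE hψ) (K.F.wOf_mem _) (K.F.wOf_rational _) (K.F.wOf_ne_zero hμ)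
    (hasBFSheafSeedOn_of_cleanAtSeed h𝓔 h4 hsr (cleanAtSeed_symH_of_hStd hE hψ K hcl))

/-! ## Entrance 2: the json checkers (rank 4: `SheafSeedCheck`; rank `r`: `SheafSeedCheckR`; rank-free) -/

/-- **R-B DOOR, rank-free json-checker entrance**: a (design, sheaf) pair passing `Design.SheafSeedCheckRankFree`
(C0′ = `Clean ∧ μ ≠ 0`, `4 ∈ I ⊆ {0..8}`, finite locally free, `I`-semiregular, `RealisedBy` against `h_std`) gives
`HasLocallyAlgebraicWeilAnchor 4 1` mod BF 5.1. [cite: BuchweitzFlenner2003, §5 Thm. 5.1]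
[cite: Deligne1982HodgeCycles, proof of Thm. 4.8] -/
theorem hasLocallyAlgebraicWeilAnchor_four_one_of_sheafSeedCheckRankFree (hE : E₀.dim = 1)
    (hψ : ψ₀ ≫ ψ₀ = -(1 • 𝟙 E₀)) (hBF : BuchweitzFlenner2003_variationalHodge_ISemiregular_model) {D : Design}
    {I : Finset ℕ} {K : AnchorKit E₀ ψ₀} {𝓔 : (pad4Anchor E₀).X.left.Modules}
    (h : D.SheafSeedCheckRankFree C I K 𝓔) : HasLocallyAlgebraicWeilAnchor 4 1 :=
  hasLocallyAlgebraicWeilAnchor_of_BFmodel_of_hyperbolicBFSheafSeedOn hBF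
    (hasHyperbolicBFSheafSeedOn_of_sheafSeedCheckRankFree hE hψ h)

/-- **R-B DOOR, rank-`r` json-checker entrance** (`r = 8` is the R-B room; `r = 4` is the v1 checker
`Design.SheafSeedCheck`, cf. `Design.sheafSeedCheck_iff_sheafSeedCheckR_four`): `Design.SheafSeedCheckR r` gives
`HasLocallyAlgebraicWeilAnchor 4 1` mod BF 5.1 — the rank clause is never used (bc5-plan g12 (b), R19.262 (3)).
[cite: BuchweitzFlenner2003, §5 Thm. 5.1] [cite: Deligne1982HodgeCycles, proof of Thm. 4.8] -/
theorem hasLocallyAlgebraicWeilAnchor_four_one_of_sheafSeedCheckR (hE : E₀.dim = 1)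
    (hψ : ψ₀ ≫ ψ₀ = -(1 • 𝟙 E₀)) (hBF : BuchweitzFlenner2003_variationalHodge_ISemiregular_model) {D : Design}
    {r : ℕ} {I : Finset ℕ} {K : AnchorKit E₀ ψ₀} {𝓔 : (pad4Anchor E₀).X.left.Modules}
    (h : D.SheafSeedCheckR r C I K 𝓔) : HasLocallyAlgebraicWeilAnchor 4 1 :=
  hasLocallyAlgebraicWeilAnchor_four_one_of_sheafSeedCheckRankFree hE hψ hBF h.rankFree

/-- The v1 (rank-4) checker entrance, for completeness. [cite: BuchweitzFlenner2003, §5 Thm. 5.1] -/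
theorem hasLocallyAlgebraicWeilAnchor_four_one_of_sheafSeedCheck (hE : E₀.dim = 1)
    (hψ : ψ₀ ≫ ψ₀ = -(1 • 𝟙 E₀)) (hBF : BuchweitzFlenner2003_variationalHodge_ISemiregular_model) {D : Design}
    {I : Finset ℕ} {K : AnchorKit E₀ ψ₀} {𝓔 : (pad4Anchor E₀).X.left.Modules}
    (h : D.SheafSeedCheck C I K 𝓔) : HasLocallyAlgebraicWeilAnchor 4 1 :=
  hasLocallyAlgebraicWeilAnchor_four_one_of_sheafSeedCheckRankFree hE hψ hBF h.rankFree

/-! ## Entrance 3: presentations (kernel = DOWN display, cokernel = UP display, monad) of a C0′ design -/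

section Presentations

variable {D : Design} {𝓔 : (pad4Anchor E₀).X.left.Modules}

/-- **R-B DOOR, kernel-presentation entrance** (DOWN two-term display `0 → 𝓔 → 𝓝 → 𝓟 → 0`): a `WordKit W` (anchor kit +
linked word frame), a kernel presentation of a C0′ design `D` by `𝓔`, `𝓔` finite locally free and `I`-semiregular
(`4 ∈ I ⊆ {0..8}`) ⊢ `HasLocallyAlgebraicWeilAnchor 4 1` mod BF 5.1. (A1@Z) is discharged by exactness
(`KernelPresentation.realisedBy`); object-side residue = C5 (locally free) + C7 (semiregular), both hypotheses here.
[cite: BuchweitzFlenner2003, §5 Thm. 5.1] [cite: Deligne1982HodgeCycles, proof of Thm. 4.8] -/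
theorem hasLocallyAlgebraicWeilAnchor_four_one_of_kernelPresentation (hE : E₀.dim = 1)
    (hψ : ψ₀ ≫ ψ₀ = -(1 • 𝟙 E₀)) (hBF : BuchweitzFlenner2003_variationalHodge_ISemiregular_model)
    (W : WordKit E₀ ψ₀) (π : KernelPresentation C W.Φ D 𝓔) (hC0 : D.ClassDataRankFree) {I : Finset ℕ} (h4 : 4 ∈ I)
    (hI : ∀ p ∈ I, p ≤ 8) (h𝓔 : IsFiniteLocallyFree 𝓔) (hsr : IsISemiregular h𝓔 {q' | q' + 1 ∈ I}) :
    HasLocallyAlgebraicWeilAnchor 4 1 :=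
  hasLocallyAlgebraicWeilAnchor_four_one_of_sheafSeedCheckRankFree hE hψ hBF
    (D.sheafSeedCheckRankFree_of_kernelPresentation W π hC0 h4 hI h𝓔 hsr)

/-- **R-B DOOR, cokernel-presentation entrance** (UP two-term display `0 → 𝓟 → 𝓝 → 𝓔 → 0` — the orientation of the
85 CAPACITY-ALIVE rows of kit j334477 and of the TW addresses). [cite: BuchweitzFlenner2003, §5 Thm. 5.1]
[cite: Deligne1982HodgeCycles, proof of Thm. 4.8] -/
theorem hasLocallyAlgebraicWeilAnchor_four_one_of_cokernelPresentation (hE : E₀.dim = 1)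
    (hψ : ψ₀ ≫ ψ₀ = -(1 • 𝟙 E₀)) (hBF : BuchweitzFlenner2003_variationalHodge_ISemiregular_model)
    (W : WordKit E₀ ψ₀) (π : CokernelPresentation C W.Φ D 𝓔) (hC0 : D.ClassDataRankFree) {I : Finset ℕ}
    (h4 : 4 ∈ I) (hI : ∀ p ∈ I, p ≤ 8) (h𝓔 : IsFiniteLocallyFree 𝓔) (hsr : IsISemiregular h𝓔 {q' | q' + 1 ∈ I}) :
    HasLocallyAlgebraicWeilAnchor 4 1 :=
  hasLocallyAlgebraicWeilAnchor_four_one_of_sheafSeedCheckRankFree hE hψ hBF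
    (D.sheafSeedCheckRankFree_of_cokernelPresentation W π hC0 h4 hI h𝓔 hsr)

/-- **R-B DOOR, monad-presentation entrance** (three-term display `𝓐 → 𝓝 → 𝓒`, `𝓔` = its homology).
[cite: BuchweitzFlenner2003, §5 Thm. 5.1] [cite: Deligne1982HodgeCycles, proof of Thm. 4.8] -/
theorem hasLocallyAlgebraicWeilAnchor_four_one_of_monadPresentation (hE : E₀.dim = 1)
    (hψ : ψ₀ ≫ ψ₀ = -(1 • 𝟙 E₀)) (hBF : BuchweitzFlenner2003_variationalHodge_ISemiregular_model)
    (W : WordKit E₀ ψ₀) (π : MonadPresentation C W.Φ D 𝓔) (hC0 : D.ClassDataRankFree) {I : Finset ℕ}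
    (h4 : 4 ∈ I) (hI : ∀ p ∈ I, p ≤ 8) (h𝓔 : IsFiniteLocallyFree 𝓔) (hsr : IsISemiregular h𝓔 {q' | q' + 1 ∈ I}) :
    HasLocallyAlgebraicWeilAnchor 4 1 :=
  hasLocallyAlgebraicWeilAnchor_four_one_of_sheafSeedCheckRankFree hE hψ hBF
    (D.sheafSeedCheckRankFree_of_monadPresentation W π hC0 h4 hI h𝓔 hsr)

end Presentations

/-! ## What the anchor buys at `d = 1`, and what the eightfold rung actually consumes -/

/-- **The `d = 1` consequence**: reach ∧ BF 5.1 (model rendering) ∧ an R-B object (rank-free json-checker form) ⊢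
`Stubs.WeilAlgebraicSplitHyperplane 4 1` — every rational Weil class on every SPLIT `ℚ(i)`-Weil abelian eightfold is
algebraic (`splitHyperplane_of_reach_of_BFmodel_of_sheafSeedOn` at `(N, d) = (4, 1)`). This — and not `SplitEightfolds`
— is the rung an R-B object would move. [cite: BuchweitzFlenner2003, §5 Thm. 5.1]
[cite: Deligne1982HodgeCycles, proof of Thm. 4.8] -/
theorem weilAlgebraicSplitHyperplane_four_one_of_sheafSeedCheckRankFree (hF : weilFamilyReach_hyperbolic)
    (hE : E₀.dim = 1) (hψ : ψ₀ ≫ ψ₀ = -(1 • 𝟙 E₀)) (hBF : BuchweitzFlenner2003_variationalHodge_ISemiregular_model)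
    {D : Design} {I : Finset ℕ} {K : AnchorKit E₀ ψ₀} {𝓔 : (pad4Anchor E₀).X.left.Modules}
    (h : D.SheafSeedCheckRankFree C I K 𝓔) : Stubs.WeilAlgebraicSplitHyperplane 4 1 :=
  splitHyperplane_of_reach_of_BFmodel_of_sheafSeedOn hF (by norm_num) (by norm_num) hBF
    (hasHyperbolicBFSheafSeedOn_of_sheafSeedCheckRankFree hE hψ h)

/-- **… and below the seed level**: the same input gives `WeilAlgebraicAll n 1` for every `2 ≤ n < 4`
(`weilAlgebraicAll_of_sheafSeedOn_lt`). [cite: BuchweitzFlenner2003, §5 Thm. 5.1]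
[cite: Schoen1998HodgeWeilAddendum, §10] -/
theorem weilAlgebraicAll_lt_four_one_of_sheafSeedCheckRankFree (hF : weilFamilyReach_hyperbolic)
    (hE : E₀.dim = 1) (hψ : ψ₀ ≫ ψ₀ = -(1 • 𝟙 E₀)) (hBF : BuchweitzFlenner2003_variationalHodge_ISemiregular_model)
    {D : Design} {I : Finset ℕ} {K : AnchorKit E₀ ψ₀} {𝓔 : (pad4Anchor E₀).X.left.Modules}
    (h : D.SheafSeedCheckRankFree C I K 𝓔) {n : ℕ} (hn2 : 2 ≤ n) (hn4 : n < 4) : WeilAlgebraicAll n 1 :=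
  weilAlgebraicAll_of_sheafSeedOn_lt hF hBF (hasHyperbolicBFSheafSeedOn_of_sheafSeedCheckRankFree hE hψ h) hn2 hn4
    (by norm_num)

/-- **WHAT `splitEightfolds_of_reach_of_localAnchor` CONSUMES** (recorded, not supplied): its hypothesis is the FAMILY
`∀ d, 0 < d → HasLocallyAlgebraicWeilAnchor 4 d`; an R-B object supplies the member `d = 1` only. Typed as the trivial
observation that a family of anchors over all `d > 0` — of which the R-B chain would be the `d = 1` entry — closes the
rung with the reach. [cite: Markman2025SecantWeil, §1.2] [cite: Deligne1982HodgeCycles, proof of Thm. 4.8] -/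
theorem splitEightfolds_of_reach_of_localAnchor_family (hF : weilFamilyReach_hyperbolic)
    (h1 : HasLocallyAlgebraicWeilAnchor 4 1) (hrest : ∀ d : ℕ, 1 < d → HasLocallyAlgebraicWeilAnchor 4 d) :
    SplitEightfolds :=
  splitEightfolds_of_reach_of_localAnchor hF fun d hd => by
    rcases Nat.lt_or_ge 1 d with hlt | hle
    · exact hrest d hlt
    · obtain rfl : d = 1 := le_antisymm hle hd
      exact h1

/-! ## Audit: nothing is decided here

Every theorem above carries its object (`𝓔` with `CleanAtSeed` ∕ a passing checker ∕ a presentation), the anchor data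
(`AnchorKit` ∕ `WordKit`) and the inputs `BuchweitzFlenner2003_variationalHodge_ISemiregular_model`,
`weilFamilyReach_hyperbolic` among its HYPOTHESES; none of them is constructed or proved in the tree. No `sorry`, no new
`def`, no instance, no notation; axioms standard. R-B ≠ 18881; nothing here is proved toward HC ∕ HC_CM ∕ HC_AV ∕ №4 ∕
26512 ∕ 18881 ∕ H2. -/

end Summit.HodgeConjecture.HodgeConjecture.Cruxes.BlochSeedDiscOne.RBDoorChain

end
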